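import Summits.QuantumFields.YangMills.Theses.WeakCouplingMasslessPhase
import Literature.MathematicalPhysics.QuantumLattice.LatticeGaugeDLRLimitPointsProofs

/-!
# Birth skeleton (BC3) for crux `DeconfinedIsMassless` (stmt-QuantumFields-19521) — `Lines/birth.lean`

Registrar: `planner-skel-stmt-QuantumFields-19521-0` (skeleton-register one-shot; route
`route-QuantumFields-WeakCouplingMasslessPhase`, a REFUTATION route:
`closes : WeakCouplingPerimeterLawD4 → DeconfinedIsMassless → ¬ YangMills`), 2026-08-17.

Crux (route file `Theses/WeakCouplingMasslessPhase.lean`, decl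
`Summit.QuantumFields.YangMills.Theses.WeakCouplingMasslessPhase.DeconfinedIsMassless`, rank 3): for every
`N ≥ 2` and every faithful continuous unitary lattice representation `r` of `SU(N)` there are two
gauge-invariant bounded local lattice observables `A, B` (`YMSpecies`) such that for every `β > 0`: IF every
infinite-volume torus limit state `μ ∈ infiniteVolumeLimitPoints (d := 4) r.ρ β` has a PERIMETER LAW for the
fundamental Wilson loop, THEN the connected torus time-correlator `latticeConnectedCorr r.ρ β (2S+1) A B n`
does NOT cluster exponentially uniformly in the torus size (`¬ ∃ C m S₀, 0 < m ∧ ∀ S ≥ S₀, ∀ n ≤ S,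
|corr| ≤ C e^{−m n}`) — "a deconfined weak-coupling phase of 4D `SU(N)` is massless".

## The cut: torus clustering ⇒ slab centre symmetry unbroken ⇒ no perimeter law (Chatterjee 2021)

The route's own TWO-LAYER PLAN, typed. Chatterjee's CENTRE SYMMETRY of the theory restricted to a slab
`{0,…,W} × ℤ³` with a fixed boundary condition `δ` (arXiv:2006.16229, Def. 2.1) is inlined over tree
declarations: a probability measure `μ` on `LGConfig 4 SU(N)` is a slab-`W` Gibbs state with boundary
condition `δ` iff (i) `μ`-a.e. every edge outside the slab interior equals `δ` — interior edges are the
time-like edges `(x, 0)` with `0 ≤ x₀ < W` and the space-like edges `(x, i ≠ 0)` with `0 < x₀ < W` — and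
(ii) `μ` is DLR for `QuantumLattice.ymSpecification (d := 4) r.ρ β Λ` for every finite `Λ` of interior
edges; the CENTRE TRANSFORM multiplies every time-like edge leaving the face `x₀ = 0` by a central `z`
(it preserves every plaquette variable, hence the specification); "centre symmetry unbroken at width `W`"
= every such `μ`, for every `δ` and every central `z`, is invariant under the transform.

* `stub_centreUnbroken_of_torusClustering` (A, XL, LOAD-BEARING — the physics of the crux): uniform
  exponential clustering of the torus time-correlator of a well-chosen pair `A, B` at coupling `β` ⇒ for
  SOME width `W = W(N, r, β) ≥ 1` the slab centre symmetry is unbroken under every boundary condition.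
* `stub_not_perimeter_of_centreUnbroken` (B, L, Chatterjee 2021 Thm 2.2 in torus-primary form): slab
  centre symmetry unbroken at some width ⇒ NO torus limit state has a perimeter law for the fundamental
  loop (Thm 2.2 gives `|⟨W_{R×T}⟩| ≤ e^{−V(R)T}` with `V(R) → ∞` in every DLR state; torus limit points are
  DLR states by `QuantumLattice.mem_ymGibbsMeasures_of_mem_infiniteVolumeLimitPoints_holds`; a perimeter
  law `|⟨W⟩| ≥ c₁ e^{−c₂(R+T)}` forces `V(R) ≤ 2c₂`, contradiction).
* Proved here (no `sorry`): `DeconfinedIsMassless_of : A → B → DeconfinedIsMassless` — pick `A, B` from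
  stub A; given `β`, the perimeter-law hypothesis and a clustering bound, stub A yields a width `W`, stub B
  then denies the perimeter law in every torus limit state, and such a state exists
  (`QuantumLattice.infiniteVolumeLimitPoints_nonempty_holds`, from `r.continuous`): contradiction.

Neither stub is the crux or the summit in disguise: A concludes a statement about SLAB Gibbs states with
boundary conditions (no Wilson loop, no perimeter law, no torus limit state) from the clustering clause; B
assumes that slab statement and speaks about Wilson loops in torus limit states (no correlator, no
species, no clustering); neither mentions OS data, schemes, `IsYangMillsFor` or `YangMills`. The finite-group
analogue of A is FALSE (`Literature.Barriers.QuantumFields.ZnHiggsPhaseD4`: `ℤ_n` at large `β` is massive AND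
has a perimeter law), so A is typed at `SU(N)`, `N ≥ 2` only and any proof must use that `SU(N)` is
connected (no action gap); the width `W` is chosen AFTER `β` because at FIXED temporal extent and large `β`
the (periodic-time) centre symmetry is broken (`Literature.Barriers.QuantumFields.FiniteTemperatureDeconfinement`,
Borgs–Seiler 1983). The full-lattice version of the centre transform is a gauge transformation (vacuous by
gauge invariance of DLR states) — hence the slab-with-boundary-condition form, exactly Chatterjee's.

BC3 probes (registrar folder `bc/probe_{A,B}_to_{crux,summit,negsummit}.lean` + `bc/probe_aesop_nosimp.lean`;
import = the route file only, NOT this file; `maxHeartbeats 400000` per example; targets the crux decl,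
`YangMills` and — because the route is a refutation route — `¬ YangMills`): 36/36 FAIL —
`intro h; exact?` 6/6 "could not close the goal"; `intro h; simpa using h` 6/6 type mismatch;
`intro h; simpa [Tgt] using h` 6/6 type mismatch; `aesop` 6/6 heartbeat timeout; the combined
`first | exact? | simpa | (simpa [Tgt]) | aesop` 6/6 fail (timeout in the last alternative);
`intro h; aesop (config := { enableSimp := false, maxRuleApplications := 400, terminal := true })` 6/6
"failed to prove the goal after exhaustive search". Raw table: `Lines/birth.md`.

## Disproof used

None exists: `Cruxes/DeconfinedIsMassless/` had no workfiles before this one (no `Disproof.lean`, no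
`Theorems/DeconfinedIsMassless/Negative/`); the summit's negatives index (7 entries: CurvatureAnchor,
SelfNormalisedSkewness, RobustYangMillsRG, MirrorModular, AdaptiveBlock, Multiboson ×2) has nothing on
centre symmetry / perimeter law / clustering-in-slabs statements.

`lean check`: rc 0, errors none; sorries = 2 = stubs (`stub_centreUnbroken_of_torusClustering`,
`stub_not_perimeter_of_centreUnbroken`), zero elsewhere; `#print axioms DeconfinedIsMassless_of` =
`propext, Classical.choice, Quot.sound`. Namespace `Summit.QuantumFields.YangMills.Cruxes.DeconfinedIsMassless.Birth`;
both stub statements are written over tree declarations only, with this file's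
`open MeasureTheory … Literature.MathematicalPhysics` in force (names appear as `QuantumLattice.X`,
`QuantumFieldTheory.Y`), without `let`s, local definitions or named arguments, so the registered signature
text (cut at the first `:=` by `ledger skeleton check`) is the whole statement (1264 / 1214 chars);
`DeconfinedIsMassless_of` takes them under the by-name aliases `Stmt.stub_*` (reducible `abbrev`s, verbatim
copies) because the skeleton audit admits only NAMED hypotheses, and `DeconfinedIsMassless_of_stubs` re-checks
that the aliases are the stub types literally (it applies `DeconfinedIsMassless_of` to the two stubs).
-/

set_option autoImplicit false

noncomputable section

namespace Summit.QuantumFields.YangMills.Cruxes.DeconfinedIsMassless.Birth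

open MeasureTheory Filter Topology
open Literature.MathematicalPhysics
open Summit.QuantumFields.YangMills.Theses.WeakCouplingMasslessPhase

/-! ### The two stubs -/

/-- **Stub A — torus clustering ⇒ slab centre symmetry unbroken (XL, LOAD-BEARING; the physics
"deconfined ⇒ massless" of the crux, contraposed).** For every `N ≥ 2` and faithful continuous unitary
`r` of `SU(N)` there are species `A, B` such that for every `β > 0`: IF the connected torus
time-correlator of `A, B` clusters exponentially, uniformly in the torus size (the crux's clause, verbatim:
`∃ C m S₀, 0 < m ∧ ∀ S ≥ S₀, ∀ n ≤ S, |latticeConnectedCorr r.ρ β (2S+1) A.F B.F n| ≤ C e^{−mn}`), THEN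
there is a width `W ≥ 1` such that every probability measure `μ` on `LGConfig 4 SU(N)` which (i) equals
the boundary condition `δ` a.e. off the slab interior (time-like edges `(x,0)`, `0 ≤ x₀ < W`; space-like
edges `(x, i ≠ 0)`, `0 < x₀ < W`) and (ii) is DLR for `ymSpecification (d := 4) r.ρ β Λ` for every finite
`Λ` inside the interior, is invariant under the centre transform `U ↦ (z · U on time-like edges with
x₀ = 0, U elsewhere)` for every central `z` — for EVERY `δ` (Chatterjee 2021 Def. 2.1, inlined).
Why plausibly true: the contrapositive says that a phase whose slab centre symmetry is broken at EVERY
width (deconfined at every temperature `1/W`, in Chatterjee's boundary-condition sense) has no uniform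
mass gap for a suitable pair of local observables — in every rigorously controlled deconfined phase of a
CONNECTED compact gauge group in `d = 4` (`U(1)₄`, Guth / Fröhlich–Spencer:
`Literature.Barriers.QuantumFields.AbelianDeconfinementD4`) the state is massless; the species are ours to
choose (`∃ A B` before `∀ β`: e.g. large fundamental Wilson loops / plaquette strings, whose torus
correlator sees the flux-tube vs. Coulomb dichotomy); `W` may grow with `β` (it must:
`FiniteTemperatureDeconfinement`). Why it might fail: it is the open bridge "torus (periodic b.c.)
clustering of ONE pair ⇒ a statement about ALL boundary conditions on slabs"; Chatterjee's Thm 2.4 needs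
decay under ARBITRARY boundary conditions for ALL edge-local `f, g`, and for finite gauge groups the
implication is false (`ZnHiggsPhaseD4`) — a proof must use connectedness of `SU(N)`. Size XL.
Leans on: `QuantumFieldTheory.{LatticeRep, YMSpecies, latticeConnectedCorr}`,
`QuantumLattice.{LGConfig, ZdEdge, ymSpecification, isSpecification_ymSpecification_t2}`, Mathlib
`Measure.map`, `Subgroup.center`, `Matrix.specialUnitaryGroup`. Sources: Chatterjee 2021
(arXiv:2006.16229) Def. 2.1, Thm 2.4 and the discussion after it (p. 7); Borgs–Seiler 1983
(doi:10.1007/bf01208780). -/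
theorem stub_centreUnbroken_of_torusClustering :
    ∀ (N : ℕ), 2 ≤ N → ∀ r : QuantumFieldTheory.LatticeRep (Matrix.specialUnitaryGroup (Fin N) ℂ), ∃ A B : QuantumFieldTheory.YMSpecies (Matrix.specialUnitaryGroup (Fin N) ℂ), ∀ β : ℝ, 0 < β → (∃ (C m : ℝ) (S₀ : ℕ), 0 < m ∧ ∀ S : ℕ, S₀ ≤ S → ∀ n : ℕ, n ≤ S → |QuantumFieldTheory.latticeConnectedCorr r.ρ β (2 * S + 1) A.F B.F n| ≤ C * Real.exp (-(m * n))) → ∃ W : ℕ, 1 ≤ W ∧ ∀ (δ : QuantumLattice.LGConfig 4 (Matrix.specialUnitaryGroup (Fin N) ℂ)) (μ : Measure (QuantumLattice.LGConfig 4 (Matrix.specialUnitaryGroup (Fin N) ℂ))), IsProbabilityMeasure μ → (∀ᵐ U ∂μ, ∀ e : QuantumLattice.ZdEdge 4, ¬ ((e.2 = 0 ∧ 0 ≤ e.1 0 ∧ e.1 0 < (W : ℤ)) ∨ (e.2 ≠ 0 ∧ 0 < e.1 0 ∧ e.1 0 < (W : ℤ))) → U e = δ e) → (∀ Λ : Finset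 (QuantumLattice.ZdEdge 4), (∀ e ∈ Λ, (e.2 = 0 ∧ 0 ≤ e.1 0 ∧ e.1 0 < (W : ℤ)) ∨ (e.2 ≠ 0 ∧ 0 < e.1 0 ∧ e.1 0 < (W : ℤ))) → ∀ E : Set (QuantumLattice.LGConfig 4 (Matrix.specialUnitaryGroup (Fin N) ℂ)), MeasurableSet E → ∫⁻ η, QuantumLattice.ymSpecification (d := 4) r.ρ β Λ η E ∂μ = μ E) → ∀ z : Matrix.specialUnitaryGroup (Fin N) ℂ, z ∈ Subgroup.center (Matrix.specialUnitaryGroup (Fin N) ℂ) → μ.map (fun (U : QuantumLattice.LGConfig 4 (Matrix.specialUnitaryGroup (Fin N) ℂ)) (e : QuantumLattice.ZdEdge 4) => if e.2 = 0 ∧ e.1 0 = 0 then z * U e else U e) = μ := by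
  sorry

/-- **Stub B — unbroken slab centre symmetry ⇒ no perimeter law in any torus limit state
(L; Chatterjee 2021 Thm 2.2, torus-primary form).** For every `N ≥ 2`, faithful continuous unitary `r`
of `SU(N)` and `β > 0`: IF for some width `W ≥ 1` the slab centre symmetry is unbroken under every
boundary condition (stub A's conclusion, verbatim), THEN no `μ ∈ infiniteVolumeLimitPoints (d := 4) r.ρ β`
has a perimeter law (`QuantumLattice.HasPerimeterLaw`) for the normalised fundamental character
`g ↦ normalisedCharacter N (fundamentalRep (Fin N) g)`.
Why plausibly true: Chatterjee 2021 Thm 2.2 — unbroken centre symmetry (Def. 2.1) and a finite-dimensional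
irreducible unitary `π` acting non-trivially on the centre give `V : ℕ → ℝ`, `V(R) → ∞`, with
`|⟨W_ℓ⟩| ≤ e^{−V(R)T}` for every rectangular `R × T` loop (`R ≤ T`) in EVERY Gibbs measure on `ℤ⁴`; here
`G' = r.ρ(SU(N)) ⊆ U(r.N)` is closed and connected, the Wilson theory of `G'` is `ymSpecification r.ρ β`,
the fundamental representation of `SU(N)`, `N ≥ 2`, acts non-trivially on the centre `{ω·1 : ωᴺ = 1}`
(`ω·1 ↦ ω ≠ 1`), torus limit points are DLR states
(`QuantumLattice.mem_ymGibbsMeasures_of_mem_infiniteVolumeLimitPoints_holds`), and a perimeter law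
`|⟨W_{R×T}⟩| ≥ c₁e^{−c₂(2R+2T)}` at `R = T → ∞` contradicts `V(R) → ∞`. The proof is Chatterjee's §§3–6
(slab restriction of a Gibbs measure is a mixture of slab Gibbs states; invariance kills the Polyakov-type
line observables crossing the face; iteration over `T/W` slabs). Why it might fail: only through a mismatch
between the inlined slab-DLR clause and Chatterjee's specification on `Ω(S, δ)` (both fix all non-interior
edges and resample interior edges with the Wilson weight of every plaquette meeting `Λ`) or the tree's
`HasPerimeterLaw` normalisation (character normalised by `N`, loops in coordinate planes) — checked by
hand, not by Lean. Size L (≈ 600–900 lines: measure disintegration over the slab faces + the line-observable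
bookkeeping). Leans on: `QuantumLattice.{infiniteVolumeLimitPoints, ymGibbsMeasures, HasPerimeterLaw,
normalisedCharacter, fundamentalRep, ymSpecification, isSpecification_ymSpecification_t2,
mem_ymGibbsMeasures_of_mem_infiniteVolumeLimitPoints_holds}`. Source: Chatterjee 2021 (arXiv:2006.16229)
Thm 2.2 (p. 6), proof §§3–6. -/
theorem stub_not_perimeter_of_centreUnbroken :
    ∀ (N : ℕ), 2 ≤ N → ∀ r : QuantumFieldTheory.LatticeRep (Matrix.specialUnitaryGroup (Fin N) ℂ), ∀ β : ℝ, 0 < β → (∃ W : ℕ, 1 ≤ W ∧ ∀ (δ : QuantumLattice.LGConfig 4 (Matrix.specialUnitaryGroup (Fin N) ℂ)) (μ : Measure (QuantumLattice.LGConfig 4 (Matrix.specialUnitaryGroup (Fin N) ℂ))), IsProbabilityMeasure μ → (∀ᵐ U ∂μ, ∀ e : QuantumLattice.ZdEdge 4, ¬ ((e.2 = 0 ∧ 0 ≤ e.1 0 ∧ e.1 0 < (W : ℤ)) ∨ (e.2 ≠ 0 ∧ 0 < e.1 0 ∧ e.1 0 < (W : ℤ))) → U e = δ e) → (∀ Λ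 : Finset (QuantumLattice.ZdEdge 4), (∀ e ∈ Λ, (e.2 = 0 ∧ 0 ≤ e.1 0 ∧ e.1 0 < (W : ℤ)) ∨ (e.2 ≠ 0 ∧ 0 < e.1 0 ∧ e.1 0 < (W : ℤ))) → ∀ E : Set (QuantumLattice.LGConfig 4 (Matrix.specialUnitaryGroup (Fin N) ℂ)), MeasurableSet E → ∫⁻ η, QuantumLattice.ymSpecification (d := 4) r.ρ β Λ η E ∂μ = μ E) → ∀ z : Matrix.specialUnitaryGroup (Fin N) ℂ, z ∈ Subgroup.center (Matrix.specialUnitaryGroup (Fin N) ℂ) → μ.map (fun (U : QuantumLattice.LGConfig 4 (Matrix.specialUnitaryGroup (Fin N) ℂ)) (e : QuantumLattice.ZdEdge 4) => if e.2 = 0 ∧ e.1 0 = 0 then z * U e else U e) = μ) → ∀ μ ∈ QuantumLattice.infiniteVolumeLimitPoints (d := 4) r.ρ β, ¬ QuantumLattice.HasPerimeterLaw μ (fun g => QuantumLattice.normalisedCharacter N (QuantumLattice.fundamentalRep (Fin N) g)) := by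
  sorry

/-! ### By-name aliases (the skeleton audit admits only named hypotheses) -/

namespace Stmt

/-- Verbatim copy of the statement of `stub_centreUnbroken_of_torusClustering`. -/
abbrev stub_centreUnbroken_of_torusClustering : Prop :=
  ∀ (N : ℕ), 2 ≤ N → ∀ r : QuantumFieldTheory.LatticeRep (Matrix.specialUnitaryGroup (Fin N) ℂ), ∃ A B : QuantumFieldTheory.YMSpecies (Matrix.specialUnitaryGroup (Fin N) ℂ), ∀ β : ℝ, 0 < β → (∃ (C m : ℝ) (S₀ : ℕ), 0 < m ∧ ∀ S : ℕ, S₀ ≤ S → ∀ n : ℕ, n ≤ S → |QuantumFieldTheory.latticeConnectedCorr r.ρ β (2 * S + 1) A.F B.F n| ≤ C * Real.exp (-(m * n))) → ∃ W : ℕ, 1 ≤ W ∧ ∀ (δ : QuantumLattice.LGConfig 4 (Matrix.specialUnitaryGroup (Fin N) ℂ)) (μ : Measure (QuantumLattice.LGConfig 4 (Matrix.specialUnitaryGroup (Fin N) ℂ))), IsProbabilityMeasure μ → (∀ᵐ U ∂μ, ∀ e : QuantumLattice.ZdEdge 4, ¬ ((e.2 = 0 ∧ 0 ≤ e.1 0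 ∧ e.1 0 < (W : ℤ)) ∨ (e.2 ≠ 0 ∧ 0 < e.1 0 ∧ e.1 0 < (W : ℤ))) → U e = δ e) → (∀ Λ : Finset (QuantumLattice.ZdEdge 4), (∀ e ∈ Λ, (e.2 = 0 ∧ 0 ≤ e.1 0 ∧ e.1 0 < (W : ℤ)) ∨ (e.2 ≠ 0 ∧ 0 < e.1 0 ∧ e.1 0 < (W : ℤ))) → ∀ E : Set (QuantumLattice.LGConfig 4 (Matrix.specialUnitaryGroup (Fin N) ℂ)), MeasurableSet E → ∫⁻ η, QuantumLattice.ymSpecification (d := 4) r.ρ β Λ η E ∂μ = μ E) → ∀ z : Matrix.specialUnitaryGroup (Fin N) ℂ, z ∈ Subgroup.center (Matrix.specialUnitaryGroup (Fin N) ℂ) → μ.map (fun (U : QuantumLattice.LGConfig 4 (Matrix.specialUnitaryGroup (Fin N) ℂ)) (e : QuantumLattice.ZdEdge 4) => if e.2 = 0 ∧ e.1 0 = 0 then z * U e else U e) = μ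

/-- Verbatim copy of the statement of `stub_not_perimeter_of_centreUnbroken`. -/
abbrev stub_not_perimeter_of_centreUnbroken : Prop :=
  ∀ (N : ℕ), 2 ≤ N → ∀ r : QuantumFieldTheory.LatticeRep (Matrix.specialUnitaryGroup (Fin N) ℂ), ∀ β : ℝ, 0 < β → (∃ W : ℕ, 1 ≤ W ∧ ∀ (δ : QuantumLattice.LGConfig 4 (Matrix.specialUnitaryGroup (Fin N) ℂ)) (μ : Measure (QuantumLattice.LGConfig 4 (Matrix.specialUnitaryGroup (Fin N) ℂ))), IsProbabilityMeasure μ → (∀ᵐ U ∂μ, ∀ e : QuantumLattice.ZdEdge 4, ¬ ((e.2 = 0 ∧ 0 ≤ e.1 0 ∧ e.1 0 < (W : ℤ)) ∨ (e.2 ≠ 0 ∧ 0 < e.1 0 ∧ e.1 0 < (W : ℤ))) → U e = δ e) → (∀ Λ : Finset (QuantumLattice.ZdEdge 4), (∀ e ∈ Λ, (e.2 = 0 ∧ 0 ≤ e.1 0 ∧ e.1 0 < (W : ℤ)) ∨ (e.2 ≠ 0 ∧ 0 < e.1 0 ∧ e.1 0 < (W : ℤ))) → ∀ E : Set (QuantumLattice.LGConfig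 4 (Matrix.specialUnitaryGroup (Fin N) ℂ)), MeasurableSet E → ∫⁻ η, QuantumLattice.ymSpecification (d := 4) r.ρ β Λ η E ∂μ = μ E) → ∀ z : Matrix.specialUnitaryGroup (Fin N) ℂ, z ∈ Subgroup.center (Matrix.specialUnitaryGroup (Fin N) ℂ) → μ.map (fun (U : QuantumLattice.LGConfig 4 (Matrix.specialUnitaryGroup (Fin N) ℂ)) (e : QuantumLattice.ZdEdge 4) => if e.2 = 0 ∧ e.1 0 = 0 then z * U e else U e) = μ) → ∀ μ ∈ QuantumLattice.infiniteVolumeLimitPoints (d := 4) r.ρ β, ¬ QuantumLattice.HasPerimeterLaw μ (fun g => QuantumLattice.normalisedCharacter N (QuantumLattice.fundamentalRep (Fin N) g))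

end Stmt

/-! ### The composition (sorry-free) -/

/-- **A → B → `DeconfinedIsMassless`** (kernel-checked; concludes the route decl by name). -/
theorem DeconfinedIsMassless_of :
    Stmt.stub_centreUnbroken_of_torusClustering → Stmt.stub_not_perimeter_of_centreUnbroken →
    DeconfinedIsMassless := by
  intro h1 h2 N hN r
  obtain ⟨A, B, hAB⟩ := h1 N hN r
  refine ⟨A, B, fun β hβ hper hclust => ?_⟩
  have hcu := hAB β hβ hclust
  obtain ⟨μ, hμ⟩ :=
    QuantumLattice.infiniteVolumeLimitPoints_nonempty_holds (d := 4) r.ρ r.continuous β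
  exact h2 N hN r β hβ hcu μ hμ (hper μ hμ)

/-- The aliases ARE the stub statements: the crux from the two stubs, literally. -/
theorem DeconfinedIsMassless_of_stubs : DeconfinedIsMassless :=
  DeconfinedIsMassless_of stub_centreUnbroken_of_torusClustering stub_not_perimeter_of_centreUnbroken

end Summit.QuantumFields.YangMills.Cruxes.DeconfinedIsMassless.Birth

end
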